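import Literature.GroupTheory.FiniteAbelian.MaximalOrderSummand
import Literature.NumberTheory.GaloisRepresentations.LocalGlobalCohomologyDualityProofs
import HarnessLib

/-!
# Route `CMKolyvaginAtInertTwo`, crux `CMKolyvaginExactAtInertTwo` (stmt-BirchSwinnertonDyer-24277):
# THE ADAPTIVE-SPLITTING STEP LEMMA and THE `p = 2` REALISABILITY CRITERION for McCallum's
# Čebotarev prescriptions (Cor. 3.2 / Thm. 5.4 at `2`) — pure group theory

Seat `bsd-line-cmk2-p1` g12 (cell `bsd-print-cf2`); helper (`--supports stmt-BirchSwinnertonDyer-24277`).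
THEOREMS ONLY: no definition, no named fact, no `sorry`; no item is closed; BSD is not proved by this.
Companion memo: `Cruxes/CMExactDescentAtTwo/MEMO-T5-adaptive-splitting.md` (this seat).

WHAT. McCallum 1991 §5 proves Kolyvagin's structure theorem for `Ш(E/K)[p^∞]` (Thm. 5.4) at ODD `p`
by choosing, at step `k+1`, ONE Kolyvagin prime `l_{k+1}` at which the classes `c(n_k)`, `c_{k+1}`
localise with FULL order and every later lift `c_i` (`i ≥ k+2`, both `τ`-signs) localises to `0`
(McCallum (21)–(23)), via Cor. 3.2 for INDEPENDENT families. Over `ℚ` at `p = 2` (the frame of the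
crux on a prime Heegner field: the pair `(E, E^{d_K})`, seat g8/g11) cross-parity classes may share
their bottom bit in `H¹(ℚ, E[2])`, and Cor. 3.2 as printed fails. The memo shows (§1) that at `2` a
full/zero prescription is realisable iff the BOTTOMS of the full classes avoid the span of the bottoms
of the zero classes, and (§3) that Thm. 5.4's induction survives if the decomposition of the remaining
isotropic block is chosen ADAPTIVELY at each step. This file is the kernel form of the two
group-theoretic cores:

* `exists_isCompl_zmultiples_not_mem` (STEP LEMMA, memo 3.3) — in a finite abelian group every
  non-zero `t` is avoided by some complement of some cyclic direct summand of order `exp G`: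
  `G = ⟨z⟩ ⊕ H`, `ord z = exp G`, `t ∉ H`. (Hungerford II §2 Ex. 2 gives `⟨z⟩ ⊕ H₀`; if `t ∈ H₀`,
  shear `H₀` along a character `H₀ → ℤ/exp G ≅ ⟨z⟩` not vanishing at `t`.) In the induction it is
  applied to the remaining lift group of the active side with `t` = the component of `bottom(c(n_k))`
  (memo (F2)), so that McCallum's (23) never collides with (21).
* `bottom_not_mem_of_realisable` / `realisable_of_bottom_not_mem` (memo Prop. 1, abstract form) —
  for a finite abelian group `C` killed by `2^M`, subgroups `Zp, Zm ≤ C` (the zero-prescribed classes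
  of each sign) and elements `a` (sign `+`), `b` (sign `−`): there are `ψ₁, ψ₂ : C → ℤ/2^M` with
  `χ₊ := ψ₁ + ψ₂` killing `Zp`, `χ₋ := ψ₁ − ψ₂` killing `Zm`, `ord χ₊(a) = ord a`, `ord χ₋(b) = ord b`
  **iff** the bottoms `(ord a / 2)·a`, `(ord b / 2)·b` lie outside `Zp[2] + Zm[2]`. Dictionary
  (memo 1.1–1.2): a depth-`M` Kolyvagin prime has `Frob_λ = (ρm)^τ(ρm)` and `x_λ ↔ ψ(x) + τψ(σ_* x)`,
  `ψ = [·, ρm]` ANY homomorphism `C → E[2^M] ≅ ℤ/2^M[τ]` (McCallum's (2)); writing `ψ = ψ₁ + ψ₂ τ`,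
  a `(+)`-eigenclass sees `χ₊(x)(1+τ)` and a `(−)`-eigenclass sees `χ₋(x)(1−τ)`.

References: [McCallumLMS1991] §3 Prop. 3.1, Cor. 3.2; §5 Thm. 5.4 (proof, (16)–(23), PDF pp. 288–289);
[Hungerford1974] Ch. II §2 Exercise 2 (maximal-order summand).
-/

-- single-conjunct summit: `Summit.BirchSwinnertonDyer.BirchSwinnertonDyer.…` repeats the name by design
set_option linter.dupNamespace false
set_option autoImplicit false

namespace Summit.BirchSwinnertonDyer.BirchSwinnertonDyer.Theorems.KolyvaginAdaptiveTwo

open Literature.GroupTheory.FiniteAbelian Literature.NumberTheory.GaloisRepresentations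

/-! ## §1 The step lemma: a maximal cyclic summand with a complement avoiding a given element -/

/-- **STEP LEMMA (adaptive splitting).** In a finite abelian group `G`, for every `t ≠ 0` there are an
element `z` of order `exp G` and a complement `H` of `⟨z⟩` (`⟨z⟩ ⊓ H = ⊥`, `⟨z⟩ ⊔ H = ⊤`) with
`t ∉ H`. Proof: Hungerford's summand `G = ⟨z⟩ ⊕ H₀`; if `t ∈ H₀`, take a character
`φ : H₀ → ℤ/exp G` with `φ t ≠ 0`, the homomorphism `ψ = (k ↦ k z) ∘ φ : H₀ → ⟨z⟩`, and the sheared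
complement `H = {w + ψ w : w ∈ H₀}`. [cite: Hungerford1974, Ch. II §2 Exercise 2 (PDF p. 141)]
[cite: McCallumLMS1991, §5 Thm. 5.4 (proof, the choice of `D_{k+1}, D_{k+2}, …`, PDF p. 288)] -/
theorem exists_isCompl_zmultiples_not_mem {G : Type*} [AddCommGroup G] [Finite G] {t : G}
    (ht : t ≠ 0) :
    ∃ z : G, addOrderOf z = AddMonoid.exponent G ∧
      ∃ H : AddSubgroup G, IsCompl (AddSubgroup.zmultiples z) H ∧ t ∉ H := by
  classical
  obtain ⟨z, hz⟩ :=
    AddMonoid.exists_addOrderOf_eq_exponent (AddMonoid.ExponentExists.of_finite (G := G))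
  obtain ⟨H₀, hH₀⟩ := exists_isCompl_zmultiples_of_addOrderOf_eq_exponent hz
  refine ⟨z, hz, ?_⟩
  by_cases htH : t ∈ H₀
  swap
  · exact ⟨H₀, hH₀, htH⟩
  -- the shear
  set m : ℕ := AddMonoid.exponent G with hm
  haveI : NeZero m := ⟨AddMonoid.exponent_ne_zero_of_finite⟩
  have hmH : ∀ w : H₀, m • w = 0 := fun w ↦
    Subtype.ext (by rw [AddSubgroupClass.coe_nsmul]; exact AddMonoid.exponent_nsmul_eq_zero (w : G))
  have ht0 : (⟨t, htH⟩ : H₀) ≠ 0 := fun h ↦ ht (congrArg Subtype.val h)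
  obtain ⟨φ, hφ⟩ := exists_addMonoidHom_zmod_apply_ne_zero hmH ht0
  -- `k ↦ k • z` factors through `ℤ/m`
  have hmz : (zmultiplesHom G z) (m : ℤ) = 0 := by
    rw [zmultiplesHom_apply, natCast_zsmul, ← hz]
    exact addOrderOf_nsmul_eq_zero z
  have hlift : ∀ k : ZMod m, ZMod.lift m ⟨zmultiplesHom G z, hmz⟩ k = ((k.val : ℕ) : ℤ) • z := by
    intro k
    have h := ZMod.lift_coe m ⟨zmultiplesHom G z, hmz⟩ ((k.val : ℕ) : ℤ)
    simp only [Int.cast_natCast, ZMod.natCast_zmod_val, zmultiplesHom_apply] at h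
    exact h
  set ψ : H₀ →+ G := (ZMod.lift m ⟨zmultiplesHom G z, hmz⟩).comp φ with hψ
  have hψapply : ∀ w : H₀, ψ w = (((φ w).val : ℕ) : ℤ) • z := fun w ↦ by
    rw [hψ, AddMonoidHom.comp_apply, hlift]
  have hψmem : ∀ w : H₀, ψ w ∈ AddSubgroup.zmultiples z := by
    intro w
    rw [hψapply]
    exact AddSubgroup.zsmul_mem _ (AddSubgroup.mem_zmultiples z) _
  set H : AddSubgroup G := (H₀.subtype + ψ).range with hH
  refine ⟨H, ⟨disjoint_iff_inf_le.2 fun g ⟨hgz, hgH⟩ ↦ ?_, codisjoint_iff_le_sup.2 fun g _ ↦ ?_⟩, ?_⟩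
  · -- `⟨z⟩ ⊓ H = ⊥`
    obtain ⟨w, rfl⟩ := AddMonoidHom.mem_range.1 hgH
    have hw : (w : G) ∈ AddSubgroup.zmultiples z := by
      have : (w : G) = ((H₀.subtype + ψ) w) - ψ w := by
        rw [AddMonoidHom.add_apply, AddSubgroup.coe_subtype, add_sub_cancel_right]
      rw [this]
      exact AddSubgroup.sub_mem _ hgz (hψmem w)
    have hw0 : (w : G) = 0 := (AddSubgroup.disjoint_def.1 hH₀.disjoint) hw w.2
    have hw0' : w = 0 := Subtype.ext hw0
    change ((H₀.subtype + ψ) w) ∈ (⊥ : AddSubgroup G)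
    rw [hw0', map_zero]
    exact AddSubgroup.zero_mem _
  · -- `⟨z⟩ ⊔ H = ⊤`
    have hg : g ∈ AddSubgroup.zmultiples z ⊔ H₀ := hH₀.codisjoint.eq_top ▸ AddSubgroup.mem_top g
    obtain ⟨a, ha, w, hw, rfl⟩ := AddSubgroup.mem_sup.1 hg
    refine AddSubgroup.mem_sup.2 ⟨a - ψ ⟨w, hw⟩, AddSubgroup.sub_mem _ ha (hψmem _),
      (H₀.subtype + ψ) ⟨w, hw⟩, AddMonoidHom.mem_range.2 ⟨_, rfl⟩, ?_⟩
    rw [AddMonoidHom.add_apply, AddSubgroup.coe_subtype]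
    abel
  · -- `t ∉ H`
    intro htH'
    obtain ⟨w, hw⟩ := AddMonoidHom.mem_range.1 htH'
    rw [AddMonoidHom.add_apply, AddSubgroup.coe_subtype] at hw
    -- `t - w = ψ w ∈ ⟨z⟩ ∩ H₀`
    have h1 : ψ w ∈ H₀ := by
      have : ψ w = t - w := eq_sub_of_add_eq' hw
      rw [this]
      exact H₀.sub_mem htH w.2
    have h2 : ψ w = 0 := (AddSubgroup.disjoint_def.1 hH₀.disjoint) (hψmem w) h1
    have h3 : (w : G) = t := by rw [← hw, h2, add_zero]
    have h4 : w = ⟨t, htH⟩ := Subtype.ext h3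
    -- so `ψ t = 0`, i.e. `(φ t) • z = 0`, i.e. `φ t = 0`
    rw [h4, hψapply, natCast_zsmul] at h2
    have h5 : addOrderOf z ∣ (φ ⟨t, htH⟩).val := addOrderOf_dvd_of_nsmul_eq_zero h2
    rw [hz] at h5
    exact hφ ((ZMod.val_eq_zero _).1
      (Nat.eq_zero_of_dvd_of_lt h5 (ZMod.val_lt _)))


/-! ## §2 The `p = 2` realisability criterion (McCallum Cor. 3.2 at `2`) in abstract form -/

section Criterion

variable {C : Type*} [AddCommGroup C]

/-- Orders in a group killed by `2^M`: a non-zero `a` has order `2^(e+1)` for some `e`, and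
`ord a / 2 = 2^e` (so that `(ord a / 2) • a` is the BOTTOM of `a`). [folklore] -/
theorem exists_addOrderOf_eq_two_pow_succ {M : ℕ} (hC : ∀ c : C, 2 ^ M • c = 0) {a : C}
    (ha : a ≠ 0) : ∃ e : ℕ, addOrderOf a = 2 ^ (e + 1) ∧ addOrderOf a / 2 = 2 ^ e := by
  obtain ⟨e₀, -, he₀⟩ :=
    (Nat.dvd_prime_pow Nat.prime_two).1 (addOrderOf_dvd_of_nsmul_eq_zero (hC a))
  have he0 : e₀ ≠ 0 := by
    rintro rfl
    rw [pow_zero, AddMonoid.addOrderOf_eq_one_iff] at he₀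
    exact ha he₀
  obtain ⟨e, rfl⟩ := Nat.exists_eq_succ_of_ne_zero he0
  refine ⟨e, he₀, ?_⟩
  rw [he₀, pow_succ, Nat.mul_div_cancel _ two_pos]

/-- **Full order through a homomorphism is decided on the bottom.** If `a` has order `2^(e+1)`
and `χ` is additive, then `ord χ(a) = ord a` iff `χ(2^e • a) ≠ 0`.
[cite: McCallumLMS1991, §3 Cor. 3.2 (proof: "`p^M c_{i,λ} = 0 ⟺ φ(p^M c_i) = 0`")] -/
theorem addOrderOf_map_eq_iff_apply_bottom_ne_zero {B : Type*} [AddCommGroup B] (χ : C →+ B)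
    {a : C} {e : ℕ} (ha : addOrderOf a = 2 ^ (e + 1)) :
    addOrderOf (χ a) = addOrderOf a ↔ χ (2 ^ e • a) ≠ 0 := by
  rw [map_nsmul]
  constructor
  · intro h h0
    have h1 : addOrderOf (χ a) ∣ 2 ^ e := addOrderOf_dvd_of_nsmul_eq_zero h0
    rw [h, ha] at h1
    have h2 := Nat.le_of_dvd (pow_pos two_pos e) h1
    have h3 : 2 ^ e < 2 ^ (e + 1) := Nat.pow_lt_pow_right (by norm_num) (Nat.lt_succ_self e)
    omega
  · intro h
    have hdvd : addOrderOf (χ a) ∣ 2 ^ (e + 1) := ha ▸ addOrderOf_map_dvd χ a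
    obtain ⟨j, hj, hje⟩ := (Nat.dvd_prime_pow Nat.prime_two).1 hdvd
    rw [ha, hje]
    rcases Nat.lt_or_ge j (e + 1) with hlt | hge
    · exfalso
      apply h
      have : addOrderOf (χ a) ∣ 2 ^ e := by
        rw [hje]
        exact pow_dvd_pow 2 (by omega)
      exact addOrderOf_dvd_iff_nsmul_eq_zero.1 this
    · rw [le_antisymm hj hge]

/-- **McCALLUM'S COR. 3.2 AT `p = 2`, NECESSITY (abstract form).** If `ψ₁, ψ₂ : C → ℤ/2^M` are
such that `χ₊ = ψ₁ + ψ₂` kills `Zp`, `χ₋ = ψ₁ - ψ₂` kills `Zm` and `χ₊(a)` has the full order of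
`a ≠ 0`, then the bottom `(ord a / 2) • a` of `a` is NOT of the form `u + v` with `u ∈ Zp`,
`v ∈ Zm`, `2u = 2v = 0` — i.e. it lies outside `Zp[2] + Zm[2]`. (For the `(−)`-side statement
apply this to `(ψ₁, -ψ₂)` with `Zp, Zm` exchanged.) Dictionary: at a depth-`M` Kolyvagin prime
with `Frob_λ = (ρm)^τ(ρm)`, `ψ = [·, ρm] = ψ₁ + ψ₂τ ∈ Hom(C, ℤ/2^M[τ])`, a `(±)`-eigenclass `x`
has `x_λ ↔ χ_±(x)(1 ± τ)`; so "full at `a`, zero on `Zp ∪ Zm`" forces `bottom(a) ∉ Zp[2] + Zm[2]`.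
[cite: McCallumLMS1991, §3 Prop. 3.1, Cor. 3.2; §5 Thm. 5.4 (21)–(23) (PDF pp. 279–280, 289)] -/
theorem bottom_ne_add_of_characters {M : ℕ} (hC : ∀ c : C, 2 ^ M • c = 0)
    {Zp Zm : AddSubgroup C} {a : C} (ha : a ≠ 0) (ψ₁ ψ₂ : C →+ ZMod (2 ^ M))
    (hp : ∀ u ∈ Zp, ψ₁ u + ψ₂ u = 0) (hm0 : ∀ v ∈ Zm, ψ₁ v - ψ₂ v = 0)
    (hfull : addOrderOf (ψ₁ a + ψ₂ a) = addOrderOf a) :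
    ∀ u ∈ Zp, ∀ v ∈ Zm, 2 • u = 0 → 2 • v = 0 → (addOrderOf a / 2) • a ≠ u + v := by
  intro u hu v hv h2u h2v hbot
  obtain ⟨e, hae, hdiv⟩ := exists_addOrderOf_eq_two_pow_succ hC ha
  rw [hdiv] at hbot
  have hfull' : addOrderOf ((ψ₁ + ψ₂) a) = addOrderOf a := by
    rw [AddMonoidHom.add_apply]
    exact hfull
  have hne := (addOrderOf_map_eq_iff_apply_bottom_ne_zero (ψ₁ + ψ₂) hae).1 hfull'
  apply hne
  rw [hbot, map_add, AddMonoidHom.add_apply, AddMonoidHom.add_apply, hp u hu, zero_add]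
  -- `χ₊(v) = χ₋(v) + 2 ψ₂(v) = 0 + ψ₂(2v) = 0`
  have : ψ₁ v + ψ₂ v = (ψ₁ v - ψ₂ v) + ψ₂ (2 • v) := by
    rw [map_nsmul, two_nsmul]
    abel
  rw [this, hm0 v hv, h2v, map_zero, add_zero]

/-- **McCALLUM'S COR. 3.2 AT `p = 2`, SUFFICIENCY (abstract form).** Let `C` be a finite abelian group
killed by `2^M`, `Zp, Zm ≤ C`, and `a, b ≠ 0` whose bottoms `(ord a / 2) • a`, `(ord b / 2) • b` are
NOT of the form `u + v` (`u ∈ Zp`, `v ∈ Zm`, `2u = 2v = 0`). Then there are `ψ₁, ψ₂ : C → ℤ/2^M`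
with `ψ₁ + ψ₂` killing `Zp`, `ψ₁ - ψ₂` killing `Zm`, `ord (ψ₁ + ψ₂)(a) = ord a` and
`ord (ψ₁ - ψ₂)(b) = ord b`. Proof: pairs `(ψ₁, ψ₂)` are the characters `Ψ` of `C × C`; the
conditions say `Ψ` kills `N = {(u,u) : u ∈ Zp} + {(v,-v) : v ∈ Zm}` and does not vanish at
`(α, α)`, `(β, -β)` (`α, β` the bottoms); `(α,α), (β,-β) ∉ N` is exactly the hypothesis, and
characters of `(C × C)/N` into `ℤ/2^M` separate points. With the dictionary of
`bottom_ne_add_of_characters` this is: the prescription "`c(n_k)`, `c_{k+1}` full, every later lift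
zero" of Thm. 5.4 is realisable by a Kolyvagin prime iff the two bottoms avoid `Zp[2] + Zm[2]`.
[cite: McCallumLMS1991, §3 Prop. 3.1, Cor. 3.2; §5 Thm. 5.4 (21)–(23) (PDF pp. 279–280, 289)] -/
theorem exists_characters_of_bottom_ne_add [Finite C] {M : ℕ} (hC : ∀ c : C, 2 ^ M • c = 0)
    (Zp Zm : AddSubgroup C) {a b : C} (ha : a ≠ 0) (hb : b ≠ 0)
    (hA : ∀ u ∈ Zp, ∀ v ∈ Zm, 2 • u = 0 → 2 • v = 0 → (addOrderOf a / 2) • a ≠ u + v)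
    (hB : ∀ u ∈ Zp, ∀ v ∈ Zm, 2 • u = 0 → 2 • v = 0 → (addOrderOf b / 2) • b ≠ u + v) :
    ∃ ψ₁ ψ₂ : C →+ ZMod (2 ^ M),
      (∀ u ∈ Zp, ψ₁ u + ψ₂ u = 0) ∧ (∀ v ∈ Zm, ψ₁ v - ψ₂ v = 0) ∧
      addOrderOf (ψ₁ a + ψ₂ a) = addOrderOf a ∧ addOrderOf (ψ₁ b - ψ₂ b) = addOrderOf b := by
  classical
  haveI : NeZero (2 ^ M) := ⟨pow_ne_zero _ two_ne_zero⟩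
  obtain ⟨e, hae, hdiva⟩ := exists_addOrderOf_eq_two_pow_succ hC ha
  obtain ⟨f, hbf, hdivb⟩ := exists_addOrderOf_eq_two_pow_succ hC hb
  -- the bottoms
  set α : C := 2 ^ e • a with hα
  set β : C := 2 ^ f • b with hβ
  have h2α : 2 • α = 0 := by
    rw [hα, ← mul_nsmul, ← pow_succ, ← hae]
    exact addOrderOf_nsmul_eq_zero a
  have h2β : 2 • β = 0 := by
    rw [hβ, ← mul_nsmul, ← pow_succ, ← hbf]
    exact addOrderOf_nsmul_eq_zero b
  rw [hdiva] at hA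
  rw [hdivb] at hB
  -- the subgroup `N = {(u,u)} + {(v,-v)}` of `C × C`
  set dg : C →+ C × C := (AddMonoidHom.id C).prod (AddMonoidHom.id C) with hdg
  set ad : C →+ C × C := (AddMonoidHom.id C).prod (-AddMonoidHom.id C) with had
  set N : AddSubgroup (C × C) := Zp.map dg ⊔ Zm.map ad with hN
  have hmemN : ∀ x : C × C, x ∈ N → ∃ u ∈ Zp, ∃ v ∈ Zm, x = (u + v, u - v) := by
    intro x hx
    obtain ⟨y, hy, z, hz, rfl⟩ := AddSubgroup.mem_sup.1 hx
    obtain ⟨u, hu, rfl⟩ := AddSubgroup.mem_map.1 hy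
    obtain ⟨v, hv, rfl⟩ := AddSubgroup.mem_map.1 hz
    refine ⟨u, hu, v, hv, ?_⟩
    simp only [hdg, had, AddMonoidHom.prod_apply, AddMonoidHom.id_apply, AddMonoidHom.neg_apply,
      Prod.mk_add_mk, sub_eq_add_neg]
  have hαN : ((α, α) : C × C) ∉ N := by
    intro h
    obtain ⟨u, hu, v, hv, huv⟩ := hmemN _ h
    obtain ⟨h1, h2⟩ := Prod.mk.inj huv
    -- `α = u + v = u - v` ⟹ `2v = 0`, `2u = 0`
    have h2v : 2 • v = 0 := by
      have : u + v = u - v := h1.symm.trans h2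
      rw [two_nsmul]
      have := sub_eq_zero.2 this
      rw [show u + v - (u - v) = v + v by abel] at this
      exact this
    have h2u : 2 • u = 0 := by
      have : 2 • (u + v) = 0 := by rw [← h1]; exact h2α
      rwa [nsmul_add, h2v, add_zero] at this
    exact hA u hu v hv h2u h2v h1
  have hβN : ((β, -β) : C × C) ∉ N := by
    intro h
    obtain ⟨u, hu, v, hv, huv⟩ := hmemN _ h
    obtain ⟨h1, h2⟩ := Prod.mk.inj huv
    -- `β = u + v`, `-β = u - v` ⟹ `2u = 0`, then `2v = 2β = 0`
    have h2u : 2 • u = 0 := by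
      have : β + -β = (u + v) + (u - v) := by rw [← h1, ← h2]
      rw [add_neg_cancel] at this
      rw [two_nsmul]
      have e2 : u + v + (u - v) = u + u := by abel
      rw [e2] at this
      exact this.symm
    have h2v : 2 • v = 0 := by
      have : 2 • (u + v) = 0 := by rw [← h1]; exact h2β
      rwa [nsmul_add, h2u, zero_add] at this
    exact hB u hu v hv h2u h2v h1
  -- characters of `(C × C)/N` separating the two classes
  haveI : Finite (C × C) := inferInstance
  have hQ : ∀ q : (C × C) ⧸ N, (2 ^ M) • q = 0 := by
    intro q
    induction q using QuotientAddGroup.induction_on with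
    | H y =>
      rw [← QuotientAddGroup.mk_nsmul, Prod.smul_mk, hC, hC, Prod.mk_zero_zero,
        QuotientAddGroup.mk_zero]
  have hqa : (QuotientAddGroup.mk ((α, α) : C × C) : (C × C) ⧸ N) ≠ 0 := fun h ↦
    hαN ((QuotientAddGroup.eq_zero_iff _).1 h)
  have hqb : (QuotientAddGroup.mk ((β, -β) : C × C) : (C × C) ⧸ N) ≠ 0 := fun h ↦
    hβN ((QuotientAddGroup.eq_zero_iff _).1 h)
  obtain ⟨φa, hφa⟩ := exists_addMonoidHom_zmod_apply_ne_zero hQ hqa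
  obtain ⟨φb, hφb⟩ := exists_addMonoidHom_zmod_apply_ne_zero hQ hqb
  -- a character non-zero at both (a group is not the union of two proper subgroups)
  obtain ⟨Φ, hΦa, hΦb⟩ : ∃ Φ : (C × C) ⧸ N →+ ZMod (2 ^ M),
      Φ (QuotientAddGroup.mk (α, α)) ≠ 0 ∧ Φ (QuotientAddGroup.mk (β, -β)) ≠ 0 := by
    by_cases h1 : φa (QuotientAddGroup.mk (β, -β)) ≠ 0
    · exact ⟨φa, hφa, h1⟩
    by_cases h2 : φb (QuotientAddGroup.mk (α, α)) ≠ 0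
    · exact ⟨φb, h2, hφb⟩
    push Not at h1 h2
    refine ⟨φa + φb, ?_, ?_⟩
    · rw [AddMonoidHom.add_apply, h2, add_zero]; exact hφa
    · rw [AddMonoidHom.add_apply, h1, zero_add]; exact hφb
  set Ψ : C × C →+ ZMod (2 ^ M) := Φ.comp (QuotientAddGroup.mk' N) with hΨ
  have hΨN : ∀ x ∈ N, Ψ x = 0 := fun x hx ↦ by
    rw [hΨ, AddMonoidHom.comp_apply, QuotientAddGroup.mk'_apply,
      (QuotientAddGroup.eq_zero_iff x).2 hx, map_zero]
  have hΨa : Ψ (α, α) ≠ 0 := by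
    rw [hΨ, AddMonoidHom.comp_apply, QuotientAddGroup.mk'_apply]
    exact hΦa
  have hΨb : Ψ (β, -β) ≠ 0 := by
    rw [hΨ, AddMonoidHom.comp_apply, QuotientAddGroup.mk'_apply]
    exact hΦb
  clear_value Ψ
  refine ⟨Ψ.comp (AddMonoidHom.inl C C), Ψ.comp (AddMonoidHom.inr C C), ?_, ?_, ?_, ?_⟩
  · -- `χ₊(u) = Ψ(u, u) = 0` on `Zp`
    intro u hu
    change Ψ (u, 0) + Ψ (0, u) = 0
    rw [← map_add, Prod.mk_add_mk, add_zero, zero_add]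
    exact hΨN _ (AddSubgroup.mem_sup_left (AddSubgroup.mem_map.2 ⟨u, hu, rfl⟩))
  · -- `χ₋(v) = Ψ(v, -v) = 0` on `Zm`
    intro v hv
    change Ψ (v, 0) - Ψ (0, v) = 0
    rw [← map_sub, Prod.mk_sub_mk, sub_zero, zero_sub]
    exact hΨN _ (AddSubgroup.mem_sup_right (AddSubgroup.mem_map.2 ⟨v, hv, rfl⟩))
  · -- full order at `a`: `χ₊(α) = Ψ(α, α) ≠ 0`
    have key : (Ψ.comp (AddMonoidHom.inl C C) + Ψ.comp (AddMonoidHom.inr C C)) (2 ^ e • a) ≠ 0 := by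
      change Ψ (2 ^ e • a, 0) + Ψ (0, 2 ^ e • a) ≠ 0
      rw [← map_add, Prod.mk_add_mk, add_zero, zero_add, ← hα]
      exact hΨa
    have := (addOrderOf_map_eq_iff_apply_bottom_ne_zero _ hae).2 key
    rwa [AddMonoidHom.add_apply] at this
  · -- full order at `b`: `χ₋(β) = Ψ(β, -β) ≠ 0`
    have key : (Ψ.comp (AddMonoidHom.inl C C) - Ψ.comp (AddMonoidHom.inr C C)) (2 ^ f • b) ≠ 0 := by
      change Ψ (2 ^ f • b, 0) - Ψ (0, 2 ^ f • b) ≠ 0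
      rw [← map_sub, Prod.mk_sub_mk, sub_zero, zero_sub, ← hβ]
      exact hΨb
    have := (addOrderOf_map_eq_iff_apply_bottom_ne_zero _ hbf).2 key
    rwa [AddMonoidHom.sub_apply] at this

end Criterion

end Summit.BirchSwinnertonDyer.BirchSwinnertonDyer.Theorems.KolyvaginAdaptiveTwo
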